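import Literature.AlgebraicGeometry.Motives.ProjectiveSpaceFormDivisors
import Literature.AlgebraicGeometry.Motives.ProjBaseChangeAny
import Literature.AlgebraicGeometry.Motives.CartierDivisorClassPullback
import HarnessLib

/-!
# Base change of the rational functions `F/x_lᵉ` of `ℙᵈ`: `(ℙᵈ_K → ℙᵈ_k)^♯ (F/x_lᵉ) = (F ⊗ 1)/x_lᵉ`

For a field extension `k → K` (any `k`-algebra which is a field), the base-change morphism
`π = Proj (k[x] → K[x]) : ℙᵈ_K → ℙᵈ_k` (Mathlib `Proj.map` of
`ProjBaseChangeRing.mapGraded k K`, Liu, *Algebraic Geometry and Arithmetic Curves*, Prop. 3.1.9 /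
Ex. 3.1.10: `ℙᵈ_K = ℙᵈ_k ×_k K`) pulls the rational function `F/x_lᵉ ∈ k(ℙᵈ_k)` of a form `F` of
degree `e` over `k` (`ProjSpace.formToFunctionField`, `Motives/ProjectiveSpaceSections`) back to
the rational function `(F ⊗ 1)/x_lᵉ ∈ K(ℙᵈ_K)` of the base-changed form
(`ProjSpace.pullbackFn_projMap_formToFunctionField`; `RatFn.pullbackFn` of
`Motives/CartierDivisorClassPullback`). This is the compatibility of local equations of the
hypersurface `V₊(F)` with base change, used to compute intersection multiplicities of `V₊(F)` with
families of subvarieties of `ℙᵈ` on the generic fibre (Fulton, *Intersection Theory*, §1.7 /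
Example 2.3 — local equations pull back to local equations).

Proof. Both rational functions are germs at the generic point of sections over the chart
`D₊(x_l)`: the tree's transported section `ProjSpace.sec l a` IS Mathlib's `Proj.awayToSection`
(`ProjSpace.sec_eq_awayToSection`: the chart morphism `GeneratingSections.chartLift (𝟙 ℙᵈ) l` is
Mathlib's `Proj.basicOpenToSpec`, and `Proj.basicOpenToSpec_app_top`); pulling a germ back along
`π` is taking the germ of `π^*` of the section (Mathlib `Scheme.Hom.germ_stalkMap`), and
`π^* ∘ awayToSection = awayToSection ∘ Away.map` (Mathlib `Proj.awayToSection_comp_appLE`);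
finally germs of `awayToSection` are read in the homogeneous localisation at the point
(Mathlib `ProjectiveSpectrum.Proj.awayToSection_germ`), where `(F ⊗ 1)/(x_l ⊗ 1)ᵉ = (F ⊗ 1)/x_lᵉ`.

Everything is proved; no named facts.

## References

* [Liu2002] Q. Liu, Algebraic Geometry and Arithmetic Curves, OUP (2002), Prop. 3.1.9,
  Ex. 3.1.10 (base change of `Proj`).
* [Fulton1998] W. Fulton, Intersection Theory, 2nd ed. (1998), §1.7, Def. 2.3 (local equations
  and pull-back).
-/

noncomputable section

open CategoryTheory AlgebraicGeometry Opposite TopologicalSpace HomogeneousLocalization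
open MvPolynomial (X C)
open Literature.AlgebraicGeometry.Motives.Segre Literature.AlgebraicGeometry.Motives.RatFn

universe u

namespace Literature.AlgebraicGeometry.Motives

attribute [local instance] MvPolynomial.gradedAlgebra

namespace ProjSpace

variable {d : ℕ} {K : Type u} [Field K]

/-! ### The tree's chart sections are Mathlib's `awayToSection` -/

/-- The chart morphism `D₊(x_l) → Spec (K[x]_{(x_l)})₀` of the generating sections of `𝟙 ℙᵈ`
(`GeneratingSections.chartLift`, the lift of the inclusion along `Proj.awayι`) is Mathlib's
`Proj.basicOpenToSpec` (both followed by `Proj.awayι` give the inclusion of `D₊(x_l)`). [folklore] -/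
theorem chartLift_id_eq_basicOpenToSpec (l : Fin (d + 1)) :
    GeneratingSections.chartLift (𝟙 (P d K)) l =
      Proj.basicOpenToSpec (grading (Fin (d + 1)) K) (X l) := by
  symm
  refine IsOpenImmersion.lift_uniq _ _ _ _ ?_
  change Proj.basicOpenToSpec (grading (Fin (d + 1)) K) (X l) ≫
      Proj.awayι (grading (Fin (d + 1)) K) (X l) (X_mem K l) zero_lt_one = _
  rw [← Proj.basicOpenIsoSpec_hom _ (X l) (X_mem K l) zero_lt_one, Proj.awayι,
    Iso.hom_inv_id_assoc, Category.comp_id]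
  rfl

/-- **`ProjSpace.sec l a = Proj.awayToSection _ x_l a`**: the section over `D₊(x_l)` of a degree-zero
fraction, as transported in `Motives/ProjectiveSpaceFunctionField`, is Mathlib's canonical section
(`Proj.basicOpenToSpec_app_top`). (A private copy of the lemma of the same name in
`Literature/AlgebraicGeometry/Resolution/VertexBlowupRationalFunctions`, to keep the blow-up files
out of the imports of the intersection-theory files.) [folklore] -/
private theorem sec_eq_awayToSection_aux (l : Fin (d + 1)) (a : Away (grading (Fin (d + 1)) K) (X l)) :
    sec l a = Proj.awayToSection (grading (Fin (d + 1)) K) (X l) a := by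
  rw [sec, chartLift_id_eq_basicOpenToSpec]
  have h : (Scheme.ΓSpecIso _).inv ≫ (Proj.basicOpenToSpec (grading (Fin (d + 1)) K) (X l)).app ⊤ =
      Proj.awayToSection (grading (Fin (d + 1)) K) (X l) ≫
        (Proj.basicOpen (grading (Fin (d + 1)) K) (X l)).topIso.inv := by
    rw [Proj.basicOpenToSpec_app_top]
    exact (Scheme.ΓSpecIso _).inv_hom_id_assoc _
  have h2 : ((Scheme.ΓSpecIso _).inv ≫ (Proj.basicOpenToSpec (grading (Fin (d + 1)) K) (X l)).app ⊤) ≫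
      (Proj.basicOpen (grading (Fin (d + 1)) K) (X l)).topIso.hom =
      Proj.awayToSection (grading (Fin (d + 1)) K) (X l) := by
    rw [h]
    erw [Category.assoc, Iso.inv_hom_id, Category.comp_id]
  exact congrArg (fun φ => φ.hom a) h2

/-- `x_l` lies outside the prime of the generic point (`η ∈ D₊(x_l)`). [folklore] -/
theorem X_mem_primeCompl_genericPoint (l : Fin (d + 1)) :
    (X l : MvPolynomial (Fin (d + 1)) K) ∈
      (genericPoint (P d K) : ProjectiveSpectrum (grading (Fin (d + 1)) K)).asHomogeneousIdeal.toIdeal.primeCompl :=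
  genericPoint_mem_U (d := d) (K := K) l

/-- **The rational function of `a ∈ (K[x]_{(x_l)})₀` read at the generic point**: the germ at the
generic point `η` of `awayToSection a` is `a` mapped into the homogeneous localisation at `η`
(Mathlib `ProjectiveSpectrum.Proj.awayToSection_germ`). [folklore] -/
theorem awayToFunctionField_eq_toFunctionField_mapId (l : Fin (d + 1))
    (a : Away (grading (Fin (d + 1)) K) (X l)) :
    awayToFunctionField l a =
      toFunctionField (genericPoint (P d K))
        ((Proj.stalkIso' (grading (Fin (d + 1)) K) (genericPoint (P d K)))
            |>.toCommRingCatIso.inv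
          (mapId (grading (Fin (d + 1)) K)
            (Submonoid.powers_le.mpr (X_mem_primeCompl_genericPoint (d := d) (K := K) l)) a)) := by
  rw [awayToFunctionField_apply, ofSection_eq_toFunctionField (genericPoint_mem_U l),
    sec_eq_awayToSection_aux]
  congr 1
  have key := ProjectiveSpectrum.Proj.awayToSection_germ (grading (Fin (d + 1)) K) (X l)
    (genericPoint (P d K)) (genericPoint_mem_U (d := d) (K := K) l)
  exact congrArg (fun φ => φ.hom a) key

end ProjSpace

/-! ### Base change `ℙᵈ_K → ℙᵈ_k` -/

namespace ProjSpace

open ProjBaseChangeRing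

variable {d : ℕ} (k K : Type u) [Field k] [Field K] [Algebra k K]

/-- The base-change morphism `π : ℙᵈ_K → ℙᵈ_k` (`Proj` of `k[x] → K[x]`). [cite: Liu2002, Prop. 3.1.9] -/
abbrev projMap : P d K ⟶ P d k :=
  Proj.map (mapGraded k K (Fin (d + 1))) (irrelevant_le_map k K (Fin (d + 1)))

variable {k K}

/-- `π⁻¹ D₊(x_l) = D₊(x_l ⊗ 1) = D₊(x_l)`. [folklore] -/
theorem projMap_preimage_U (l : Fin (d + 1)) :
    projMap (d := d) k K ⁻¹ᵁ U l = U l := by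
  change Proj.basicOpen (grading (Fin (d + 1)) K) (mapGraded k K (Fin (d + 1)) (X l)) = _
  rw [mapGraded_X]
  rfl

/-- The generic point of `ℙᵈ_K` lies in `D₊(x_l ⊗ 1)`. [folklore] -/
theorem genericPoint_mem_basicOpen_mapGraded_X (l : Fin (d + 1)) :
    genericPoint (P d K) ∈
      Proj.basicOpen (grading (Fin (d + 1)) K) (mapGraded k K (Fin (d + 1)) (X l)) := by
  have h : Proj.basicOpen (grading (Fin (d + 1)) K) (mapGraded k K (Fin (d + 1)) (X l)) = U l := by
    rw [mapGraded_X]; rfl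
  rw [h]
  exact genericPoint_mem_U l

/-- `x_l ⊗ 1` lies outside the prime of the generic point of `ℙᵈ_K`. [folklore] -/
theorem mapGraded_X_mem_primeCompl_genericPoint (l : Fin (d + 1)) :
    mapGraded k K (Fin (d + 1)) (X l) ∈
      (genericPoint (P d K) : ProjectiveSpectrum (grading (Fin (d + 1)) K)).asHomogeneousIdeal.toIdeal.primeCompl :=
  genericPoint_mem_basicOpen_mapGraded_X (k := k) (d := d) l

/-- `π (η_K) ∈ D₊(x_l)`. [folklore] -/
theorem projMap_genericPoint_mem_U (l : Fin (d + 1)) :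
    projMap (d := d) k K (genericPoint (P d K)) ∈ U (d := d) (K := k) l :=
  genericPoint_mem_basicOpen_mapGraded_X (k := k) l

/-- **The pull-back of the rational function of `a ∈ (k[x]_{(x_l)})₀` along `π : ℙᵈ_K → ℙᵈ_k`**,
read in the homogeneous localisation of `K[x]` at the generic point: it is `Away.map (k[x] → K[x]) a`
mapped there (Mathlib `Proj.awayToSection_comp_appLE`, `Scheme.Hom.germ_stalkMap`,
`ProjectiveSpectrum.Proj.awayToSection_germ`). [cite: Liu2002, Prop. 3.1.9] -/
theorem pullbackFn_projMap_awayToFunctionField (l : Fin (d + 1))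
    (a : Away (grading (Fin (d + 1)) k) (X l)) :
    pullbackFn (projMap (d := d) k K) (awayToFunctionField l a) =
      toFunctionField (genericPoint (P d K))
        ((Proj.stalkIso' (grading (Fin (d + 1)) K) (genericPoint (P d K)))
            |>.toCommRingCatIso.inv
          (mapId (grading (Fin (d + 1)) K)
            (Submonoid.powers_le.mpr (mapGraded_X_mem_primeCompl_genericPoint (k := k) (d := d) l))
            (Away.map (mapGraded k K (Fin (d + 1))) (X l) a))) := by
  set π := projMap (d := d) k K with hπ
  have hx : π (genericPoint (P d K)) ∈ U (d := d) (K := k) l := projMap_genericPoint_mem_U l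
  rw [awayToFunctionField_apply, show ofSection (genericPoint_mem_U (d := d) (K := k) l) (sec l a) =
      ofSection (genericPoint_mem_of_mem hx) (sec l a) from rfl,
    ofSection_eq_toFunctionField hx, pullbackFn_toFunctionField, Scheme.Hom.germ_stalkMap_apply]
  congr 1
  -- `π^*(awayToSection a) = awayToSection (Away.map a)`
  have happ : π.app (U l) (sec l a) =
      Proj.awayToSection (grading (Fin (d + 1)) K) (mapGraded k K (Fin (d + 1)) (X l))
        (Away.map (mapGraded k K (Fin (d + 1))) (X l) a) := by
    rw [sec_eq_awayToSection_aux, Scheme.Hom.app_eq_appLE]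
    have key := Proj.awayToSection_comp_appLE (mapGraded k K (Fin (d + 1)))
      (irrelevant_le_map k K (Fin (d + 1))) (X_mem k l)
    exact congrArg (fun φ => φ.hom a) key
  rw [happ]
  have key := ProjectiveSpectrum.Proj.awayToSection_germ (grading (Fin (d + 1)) K)
    (mapGraded k K (Fin (d + 1)) (X l)) (genericPoint (P d K))
    (genericPoint_mem_basicOpen_mapGraded_X (k := k) (d := d) l)
  exact congrArg (fun φ => φ.hom (Away.map (mapGraded k K (Fin (d + 1))) (X l) a)) key

/-- The two degree-zero fractions `(F ⊗ 1)/(x_l ⊗ 1)ᵉ` (image of `F/x_lᵉ` under `Away.map`) and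
`(F ⊗ 1)/x_lᵉ` have the same image in the homogeneous localisation at the generic point (their
numerators and denominators agree: `x_l ⊗ 1 = x_l`). [folklore] -/
theorem mapId_awayMap_mk_eq (l : Fin (d + 1)) {e : ℕ} {F : MvPolynomial (Fin (d + 1)) k}
    (hF : F ∈ grading (Fin (d + 1)) k (e • 1)) :
    mapId (grading (Fin (d + 1)) K)
        (Submonoid.powers_le.mpr (mapGraded_X_mem_primeCompl_genericPoint (k := k) (d := d) l))
        (Away.map (mapGraded k K (Fin (d + 1))) (X l) (Away.mk _ (X_mem k l) e F hF)) =
      mapId (grading (Fin (d + 1)) K)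
        (Submonoid.powers_le.mpr (X_mem_primeCompl_genericPoint (d := d) (K := K) l))
        (Away.mk _ (X_mem K l) e (MvPolynomial.map (algebraMap k K) F)
          ((mapGraded k K (Fin (d + 1))).map_mem hF)) := by
  rw [Away.map_mk]
  apply HomogeneousLocalization.val_injective
  simp only [Away.mk, mapId, HomogeneousLocalization.map_mk, HomogeneousLocalization.val_mk]
  congr 1
  apply Subtype.ext
  change (mapGraded k K (Fin (d + 1))) (X l) ^ e = X l ^ e
  rw [mapGraded_X]

/-- **Base change of `F/x_lᵉ`: `π^♯ (F/x_lᵉ) = (F ⊗ 1)/x_lᵉ`** for the base-change morphism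
`π : ℙᵈ_K → ℙᵈ_k` and a form `F` of degree `e` over `k` — the local equations of the hypersurface
`V₊(F) ⊆ ℙᵈ_k` on the standard charts pull back to the local equations of `V₊(F ⊗ 1) ⊆ ℙᵈ_K`.
[cite: Liu2002, Prop. 3.1.9 and Ex. 3.1.10] [cite: Fulton1998, Def. 2.3] -/
theorem pullbackFn_projMap_formToFunctionField (l : Fin (d + 1)) {e : ℕ}
    {F : MvPolynomial (Fin (d + 1)) k} (hF : F ∈ grading (Fin (d + 1)) k e) :
    pullbackFn (projMap (d := d) k K) (formToFunctionField l F) =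
      formToFunctionField l (MvPolynomial.map (algebraMap k K) F) := by
  have hF' : F ∈ grading (Fin (d + 1)) k (e • 1) := by simpa using hF
  have hFK : MvPolynomial.map (algebraMap k K) F ∈ grading (Fin (d + 1)) K (e • 1) :=
    (mapGraded k K (Fin (d + 1))).map_mem hF'
  rw [formToFunctionField_of_mem l hF', formToFunctionField_of_mem l hFK,
    pullbackFn_projMap_awayToFunctionField, awayToFunctionField_eq_toFunctionField_mapId,
    mapId_awayMap_mk_eq]

end ProjSpace

end Literature.AlgebraicGeometry.Motives

end
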